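import Summits.ValiantsHypothesis.ValiantsHypothesis.Theorems.SymPencilPerFourInnerRankIsotropicSlice
import Mathlib.LinearAlgebra.Matrix.Block

/-!
# Route `SymPencil` — inner rank of the `2 | 2` row split of `per_4`, the pure Gram problem P1:
# the counting inequality `|ι| ≥ 6 + A + B` and the two end cases
# (`--supports` stmt-ValiantsHypothesis-5674 `SdcSuperquadratic`; (8,8) column, cells `(8,8,10)` /
# `(8,8,11)`; rung currency only)

SETTING (as in `…InnerRankPureSymm`).  A PURE joint family: `Σ_r c_r t_r(u,y)² = per (a; b; y₂; y₃)`,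
the `y₂`-block of `t` depends only on `b`, the `y₃`-block only on `a` (`hX`).  Vectors in `K^ι`:
`n_{bk} = (t_r((0,e_b),(e_k,0)))_r`, `m_{al} = (t_r((e_a,0),(0,e_l)))_r`, `⟨x,x'⟩ = Σ_r c_r x_r x'_r`.
The ten "kernel" combinations on the `ν`-side are `n_{bb}` and `n_{pq} - n_{qp}`, i.e. `x = Σ ξ_{bk} n_{bk}`
with `ξ` DIAGONAL-PLUS-ANTISYMMETRIC (`ξ_{bk} = -ξ_{kb}` for `b ≠ k`); they pair to zero with every
`m_{al}` (`⟨n_{bk}, m_{al}⟩ = ½ per (e_a; e_b; e_k; e_l)` is symmetric in `b, k` and vanishes for `b = k`).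
Likewise on the `μ`-side.  `A` (`B`) = the dimension of the span of their functionals `⟨x, ·⟩`.

**Theorem 1** (`twelve_le_card_of_six_three_three`, pure linear algebra).  Given `p_T, q_T` (`T < 6`)
with `det ⟨p_T, q_T'⟩ ≠ 0`, three vectors `x_i ⊥ q`, with `det ⟨x_i, g_i'⟩ ≠ 0` for some tests `g`,
and three vectors `y_j ⊥ p`, `y_j ⊥ x`, with `det ⟨y_j, h_j'⟩ ≠ 0`: then `12 ≤ |ι|`.  (The nine
functionals `⟨p_T,·⟩, ⟨x_i,·⟩` are independent — block-triangular pairing against `q, g` — and the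
three independent `y_j` lie in their common kernel.)

**Theorem 2** (`false_of_allX_of_kernel_three_three`) — THE GENERIC CASE OF P1: with `|ι| ≤ 11` and
purity, three `ν`-side kernel combinations with independent functionals (a `3 × 3` pairing
certificate) together with three such on the `μ`-side are contradictory (`p = N̂_S`, `q = m_{Sᶜ}`, the
perfect pairing of `…PureSymm`).  This is step (1) «`ρ ≥ 6 + A + B`» of the proof of P1 recorded in
`pub/val-lit/lmr/p8g14-P1/README.md`: a rank-`11` pure design must have `A ≤ 2` or `B ≤ 2`.

**Theorem 3** (`false_of_allX_of_nGram_zero`, `false_of_allX_of_mGram_zero`) — THE CASE `A = 0`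
(resp. `B = 0`): if all `⟨n_{bk}, n_{b'k'}⟩` vanish, the six `N̂_S` are isotropic and dual to the
`m_{Sᶜ}`, so `|ι| ≥ 12` (`…IsotropicSlice.twelve_le_card_of_isotropic_six`).

What remains for a kernel proof of P1 (paper proof with exact certificates in `lmr/p8g14-P1/`):
step (2) «`A ≤ 2` ⇒ the `ν`-Gram lies on one of three lines» (a 151-node case tree of `3 × 3` product
minors, `certtree3.py`) and steps (4)–(5) «on those lines `|ι| ≥ 12`» (a 36-step chain of `2 × 2`
minors per line, `certchain_*.json`).  Honest framing: lemmas; the cells `(8,8,10)`, `(8,8,11)` stay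
open; the window `27 ≤ sdc(per_4) ≤ 29`, the crux `SdcSuperquadratic` and `VP ≠ VNP` are untouched.
No definitions, no named facts. [folklore]
-/

noncomputable section

-- single-conjunct layout: Sub = Summit, duplicated namespace component intended
set_option linter.dupNamespace false

namespace Summit.ValiantsHypothesis.ValiantsHypothesis.Theorems.SymPencilPerFourInnerRankPureGramCount

open Matrix Finset Module
open Summit.ValiantsHypothesis.ValiantsHypothesis.Theorems.SymPencilPerFourInnerRankRows
open Summit.ValiantsHypothesis.ValiantsHypothesis.Theorems.SymPencilPerFourInnerRankTenFamily
open Summit.ValiantsHypothesis.ValiantsHypothesis.Theorems.SymPencilPerFourInnerRankIsotropicSlice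

variable {K : Type*} [Field K] {ι : Type*} [Fintype ι]

/-! ### Linear algebra: nine independent functionals and three kernel vectors -/

/-- **Counting core.**  `p, q : Fin 6 → K^ι` with invertible pairing, `x : Fin 3 → K^ι` orthogonal to
the `q`'s with an invertible pairing against tests `g`, and `y : Fin 3 → K^ι` orthogonal to the `p`'s
and the `x`'s with an invertible pairing against tests `h` force `12 ≤ |ι|` (pairing
`⟨u,v⟩ = Σ_r c_r u_r v_r`, no hypothesis on `c`). [folklore] -/
theorem twelve_le_card_of_six_three_three [DecidableEq ι] (c : ι → K)
    (p q : Fin 6 → ι → K) (x g y h : Fin 3 → ι → K)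
    (hpq : (Matrix.of fun T T' : Fin 6 => ∑ r, c r * p T r * q T' r).det ≠ 0)
    (hxq : ∀ (i : Fin 3) (T : Fin 6), ∑ r, c r * x i r * q T r = 0)
    (hxg : (Matrix.of fun i i' : Fin 3 => ∑ r, c r * x i r * g i' r).det ≠ 0)
    (hyp : ∀ (j : Fin 3) (T : Fin 6), ∑ r, c r * y j r * p T r = 0)
    (hyx : ∀ (j : Fin 3) (i : Fin 3), ∑ r, c r * y j r * x i r = 0)
    (hyh : (Matrix.of fun j j' : Fin 3 => ∑ r, c r * y j r * h j' r).det ≠ 0) :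
    12 ≤ Fintype.card ι := by
  -- the nine functionals, indexed by `Fin 6 ⊕ Fin 3`
  let f : Fin 6 ⊕ Fin 3 → ι → K := Sum.elim p x
  let w : Fin 6 ⊕ Fin 3 → ι → K := Sum.elim q g
  let ψ : (ι → K) →ₗ[K] (Fin 6 ⊕ Fin 3 → K) :=
    { toFun := fun v s => ∑ r, c r * f s r * v r
      map_add' := fun v v' => by
        funext s
        simp only [Pi.add_apply, mul_add, Finset.sum_add_distrib]
      map_smul' := fun a v => by
        funext s
        simp only [Pi.smul_apply, smul_eq_mul, RingHom.id_apply, Finset.mul_sum]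
        exact Finset.sum_congr rfl fun r _ => by ring }
  have hψ : ∀ v s, ψ v s = ∑ r, c r * f s r * v r := fun v s => rfl
  -- the pairing matrix of the nine functionals against `w` is block upper triangular
  set A : Matrix (Fin 6) (Fin 6) K := Matrix.of fun T T' => ∑ r, c r * p T r * q T' r with hA
  set Bm : Matrix (Fin 6) (Fin 3) K := Matrix.of fun T i' => ∑ r, c r * p T r * g i' r with hBm
  set D : Matrix (Fin 3) (Fin 3) K := Matrix.of fun i i' => ∑ r, c r * x i r * g i' r with hD
  set P : Matrix (Fin 6 ⊕ Fin 3) (Fin 6 ⊕ Fin 3) K := Matrix.fromBlocks A Bm 0 D with hP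
  have hPdet : P.det ≠ 0 := by
    rw [hP, Matrix.det_fromBlocks_zero₂₁]
    exact mul_ne_zero hpq hxg
  have hcol : ∀ s', ψ (w s') = P.col s' := by
    intro s'
    funext s
    rw [hψ]
    rcases s with T | i <;> rcases s' with T' | i'
    · simp [f, w, hP, hA, Matrix.fromBlocks]
    · simp [f, w, hP, hBm, Matrix.fromBlocks]
    · simp [f, w, hP, Matrix.fromBlocks, hxq]
    · simp [f, w, hP, hD, Matrix.fromBlocks]
  have hli : LinearIndependent K (fun s' => ψ (w s')) := by
    rw [show (fun s' => ψ (w s')) = P.col from funext hcol]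
    exact Matrix.linearIndependent_cols_of_det_ne_zero hPdet
  have hrange : LinearMap.range ψ = ⊤ := by
    apply le_antisymm le_top
    have hspan : Submodule.span K (Set.range fun s' => ψ (w s')) = ⊤ :=
      hli.span_eq_top_of_card_eq_finrank' (by simp)
    rw [← hspan, Submodule.span_le]
    rintro _ ⟨s', rfl⟩
    exact LinearMap.mem_range_self ψ (w s')
  have hker : finrank K (LinearMap.ker ψ) + 9 = Fintype.card ι := by
    have h := LinearMap.finrank_range_add_finrank_ker ψ
    rw [hrange, finrank_top, finrank_fintype_fun_eq_card, finrank_fintype_fun_eq_card,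
      Fintype.card_sum, Fintype.card_fin, Fintype.card_fin] at h
    omega
  -- the `y j` are independent and lie in `ker ψ`
  set Q : Matrix (Fin 3) (Fin 3) K := Matrix.of fun j j' => ∑ r, c r * y j r * h j' r with hQ
  have hy : LinearIndependent K y := by
    rw [Fintype.linearIndependent_iff]
    intro a ha j
    have hvec : a ᵥ* Q = 0 := by
      funext j'
      rw [Matrix.vecMul_eq_sum]
      simp only [Finset.sum_apply, Pi.smul_apply, smul_eq_mul, hQ, Matrix.of_apply,
        Pi.zero_apply]
      have h0 : ∑ r, c r * (∑ j, a j • y j) r * h j' r = 0 := by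
        rw [ha]; simp
      rw [← h0]
      simp only [Finset.sum_apply, Pi.smul_apply, smul_eq_mul, Finset.mul_sum, Finset.sum_mul]
      rw [Finset.sum_comm]
      exact Finset.sum_congr rfl fun r _ => Finset.sum_congr rfl fun j _ => by ring
    exact congr_fun (Matrix.eq_zero_of_vecMul_eq_zero hyh hvec) j
  have hle : Submodule.span K (Set.range y) ≤ LinearMap.ker ψ := by
    rw [Submodule.span_le]
    rintro _ ⟨j, rfl⟩
    rw [SetLike.mem_coe, LinearMap.mem_ker]
    funext s
    rw [hψ, Pi.zero_apply]
    rcases s with T | i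
    · simp only [f, Sum.elim_inl]
      rw [← hyp j T]
      exact Finset.sum_congr rfl fun r _ => by ring
    · simp only [f, Sum.elim_inr]
      rw [← hyx j i]
      exact Finset.sum_congr rfl fun r _ => by ring
  have h3 : finrank K (Submodule.span K (Set.range y)) = 3 := by
    rw [finrank_span_eq_card hy, Fintype.card_fin]
  have hmono := Submodule.finrank_mono hle
  omega

/-! ### The design: kernel combinations and the perfect pairing `N̂_S ↔ m_{Sᶜ}` -/

section design

variable [CharZero K] [DecidableEq ι] (c : ι → K)
  (t : ι → (((Fin 4 → K) × (Fin 4 → K)) →ₗ[K] ((Fin 4 → K) × (Fin 4 → K)) →ₗ[K] K))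

omit [CharZero K] [DecidableEq ι] in
/-- **Purity Gram table**: `2 ⟨n_{jk}, m_{il}⟩ = per (e_i; e_j; e_k; e_l)`. [folklore] -/
theorem two_mul_gram_nm
    (hJ : ∀ a b y₂ y₃ : Fin 4 → K,
      ∑ r, c r * (t r (a, b) (y₂, y₃)) ^ 2 = (Matrix.of ![a, b, y₂, y₃]).permanent)
    (hX : ∀ k : Fin 4, (∀ (a : Fin 4 → K) r, t r (a, 0) (Pi.single k 1, 0) = 0) ∧
        (∀ (b : Fin 4 → K) r, t r (0, b) (0, Pi.single k 1) = 0))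
    (i j k l : Fin 4) :
    2 * ∑ r, c r * t r (0, Pi.single j 1) (Pi.single k 1, 0) *
        t r (Pi.single i 1, 0) (0, Pi.single l 1) =
      (Matrix.of ![Pi.single i (1 : K), Pi.single j 1, Pi.single k 1, Pi.single l 1]).permanent := by
  have hsplit : ∀ (a b : Fin 4 → K) (y : (Fin 4 → K) × (Fin 4 → K)) r,
      t r (a, b) y = t r (a, 0) y + t r (0, b) y := fun a b y r => by
    rw [← LinearMap.add_apply, ← map_add]; simp
  have h := polar c t hJ (Pi.single i 1) (Pi.single j 1) (Pi.single k 1) 0 0 (Pi.single l 1)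
  rw [per_zero_row₂, add_zero] at h
  have h1 : ∀ r, t r (Pi.single i 1, Pi.single j 1) (Pi.single k 1, 0) =
      t r (0, Pi.single j 1) (Pi.single k 1, 0) := fun r => by
    rw [hsplit, (hX k).1, zero_add]
  have h2 : ∀ r, t r (Pi.single i 1, Pi.single j 1) (0, Pi.single l 1) =
      t r (Pi.single i 1, 0) (0, Pi.single l 1) := fun r => by
    rw [hsplit, (hX l).2, add_zero]
  simp_rw [h1, h2] at h
  exact h

omit [CharZero K] in
/-- `per (e_i; e_b; e_b; e_l) = 0` (a repeated coordinate row). [folklore] -/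
theorem per_single_rep (i b l : Fin 4) :
    (Matrix.of ![Pi.single i (1 : K), Pi.single b 1, Pi.single b 1, Pi.single l 1]).permanent = 0 := by
  fin_cases b <;> simp [permanent_of_rows]

omit [DecidableEq ι] in
/-- **Kernel combinations pair to zero with the `μ`-vectors.**  For `ξ` diagonal-plus-antisymmetric,
`⟨Σ ξ_{bk} n_{bk}, m_{al}⟩ = 0`. [folklore] -/
theorem kernel_comb_orth_m
    (hJ : ∀ a b y₂ y₃ : Fin 4 → K,
      ∑ r, c r * (t r (a, b) (y₂, y₃)) ^ 2 = (Matrix.of ![a, b, y₂, y₃]).permanent)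
    (hX : ∀ k : Fin 4, (∀ (a : Fin 4 → K) r, t r (a, 0) (Pi.single k 1, 0) = 0) ∧
        (∀ (b : Fin 4 → K) r, t r (0, b) (0, Pi.single k 1) = 0))
    (ξ : Fin 4 → Fin 4 → K) (hξ : ∀ b k, b ≠ k → ξ b k = -ξ k b) (a l : Fin 4) :
    ∑ r, c r * (∑ b, ∑ k, ξ b k * t r (0, Pi.single b 1) (Pi.single k 1, 0)) *
        t r (Pi.single a 1, 0) (0, Pi.single l 1) = 0 := by
  -- reduce to the Gram table
  have hG : ∀ b k, ∑ r, c r * t r (0, Pi.single b 1) (Pi.single k 1, 0) *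
      t r (Pi.single a 1, 0) (0, Pi.single l 1) =
      (Matrix.of ![Pi.single a (1 : K), Pi.single b 1, Pi.single k 1, Pi.single l 1]).permanent / 2 :=
    fun b k => by
    rw [← two_mul_gram_nm c t hJ hX a b k l]; ring
  have hswap : ∀ b k : Fin 4,
      (Matrix.of ![Pi.single a (1 : K), Pi.single k 1, Pi.single b 1, Pi.single l 1]).permanent =
        (Matrix.of ![Pi.single a (1 : K), Pi.single b 1, Pi.single k 1, Pi.single l 1]).permanent :=
    fun b k => by simp only [permanent_of_rows]; ring
  calc ∑ r, c r * (∑ b, ∑ k, ξ b k * t r (0, Pi.single b 1) (Pi.single k 1, 0)) *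
        t r (Pi.single a 1, 0) (0, Pi.single l 1)
      = ∑ b, ∑ k, ξ b k * ((Matrix.of ![Pi.single a (1 : K), Pi.single b 1, Pi.single k 1,
          Pi.single l 1]).permanent / 2) := by
        simp_rw [← hG, Finset.mul_sum, Finset.sum_mul]
        rw [Finset.sum_comm]
        refine Finset.sum_congr rfl fun b _ => ?_
        rw [Finset.sum_comm]
        exact Finset.sum_congr rfl fun k _ => Finset.sum_congr rfl fun r _ => by ring
    _ = 0 := by
        -- pair the terms `(b,k)` and `(k,b)`
        have hpair : ∀ b k : Fin 4, ξ b k * ((Matrix.of ![Pi.single a (1 : K), Pi.single b 1,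
            Pi.single k 1, Pi.single l 1]).permanent / 2) +
            ξ k b * ((Matrix.of ![Pi.single a (1 : K), Pi.single k 1, Pi.single b 1,
            Pi.single l 1]).permanent / 2) = 0 := by
          intro b k
          by_cases hbk : b = k
          · subst hbk; rw [per_single_rep]; ring
          · rw [hswap, hξ b k hbk]; ring
        have hsum : ∑ b, ∑ k, ξ b k * ((Matrix.of ![Pi.single a (1 : K), Pi.single b 1,
            Pi.single k 1, Pi.single l 1]).permanent / 2) =
            ∑ b, ∑ k, ξ k b * ((Matrix.of ![Pi.single a (1 : K), Pi.single k 1,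
            Pi.single b 1, Pi.single l 1]).permanent / 2) := Finset.sum_comm
        have h2 := Finset.sum_add_distrib (s := (Finset.univ : Finset (Fin 4)))
          (f := fun b => ∑ k, ξ b k * ((Matrix.of ![Pi.single a (1 : K), Pi.single b 1,
            Pi.single k 1, Pi.single l 1]).permanent / 2))
          (g := fun b => ∑ k, ξ k b * ((Matrix.of ![Pi.single a (1 : K), Pi.single k 1,
            Pi.single b 1, Pi.single l 1]).permanent / 2))
        have h3 : ∀ b : Fin 4, (∑ k, ξ b k * ((Matrix.of ![Pi.single a (1 : K), Pi.single b 1,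
            Pi.single k 1, Pi.single l 1]).permanent / 2)) +
            (∑ k, ξ k b * ((Matrix.of ![Pi.single a (1 : K), Pi.single k 1,
            Pi.single b 1, Pi.single l 1]).permanent / 2)) = 0 := fun b => by
          rw [← Finset.sum_add_distrib]
          exact Finset.sum_eq_zero fun k _ => hpair b k
        have h4 : ∑ b : Fin 4, ((∑ k, ξ b k * ((Matrix.of ![Pi.single a (1 : K), Pi.single b 1,
            Pi.single k 1, Pi.single l 1]).permanent / 2)) +
            (∑ k, ξ k b * ((Matrix.of ![Pi.single a (1 : K), Pi.single k 1,
            Pi.single b 1, Pi.single l 1]).permanent / 2))) = 0 :=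
          Finset.sum_eq_zero fun b _ => h3 b
        rw [Finset.sum_add_distrib, ← hsum] at h4
        linear_combination h4 / 2

omit [DecidableEq ι] in
/-- **The perfect pairing** `⟨N̂_S, m_{S'ᶜ}⟩ = [S = S']` for `N̂_S = n_{pq} + n_{qp}` (`S = {p,q}`) and
the `m` of the complementary pair, as a matrix identity. [folklore] -/
theorem pairing_N6_M6
    (hJ : ∀ a b y₂ y₃ : Fin 4 → K,
      ∑ r, c r * (t r (a, b) (y₂, y₃)) ^ 2 = (Matrix.of ![a, b, y₂, y₃]).permanent)
    (hX : ∀ k : Fin 4, (∀ (a : Fin 4 → K) r, t r (a, 0) (Pi.single k 1, 0) = 0) ∧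
        (∀ (b : Fin 4 → K) r, t r (0, b) (0, Pi.single k 1) = 0)) :
    let n : Fin 4 → Fin 4 → ι → K := fun j k r => t r (0, Pi.single j 1) (Pi.single k 1, 0)
    let m : Fin 4 → Fin 4 → ι → K := fun i l r => t r (Pi.single i 1, 0) (0, Pi.single l 1)
    let N6 : Fin 6 → ι → K :=
      ![n 0 1 + n 1 0, n 0 2 + n 2 0, n 0 3 + n 3 0, n 1 2 + n 2 1, n 1 3 + n 3 1, n 2 3 + n 3 2]
    let M6 : Fin 6 → ι → K := ![m 2 3, m 1 3, m 1 2, m 0 3, m 0 2, m 0 1]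
    (Matrix.of fun S S' : Fin 6 => ∑ r, c r * N6 S r * M6 S' r) = 1 := by
  intro n m N6 M6
  have gram : ∀ i j k l : Fin 4, 2 * ∑ r, c r * n j k r * m i l r =
      (Matrix.of ![Pi.single i (1 : K), Pi.single j 1, Pi.single k 1, Pi.single l 1]).permanent :=
    fun i j k l => two_mul_gram_nm c t hJ hX i j k l
  have gramHat : ∀ i p q l : Fin 4, ∑ r, c r * (n p q + n q p) r * m i l r =
      ((Matrix.of ![Pi.single i (1 : K), Pi.single p 1, Pi.single q 1, Pi.single l 1]).permanent
        + (Matrix.of ![Pi.single i (1 : K), Pi.single q 1, Pi.single p 1, Pi.single l 1]).permanent)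
          / 2 := by
    intro i p q l
    have hs : ∑ r, c r * (n p q + n q p) r * m i l r =
        ∑ r, c r * n p q r * m i l r + ∑ r, c r * n q p r * m i l r := by
      rw [← Finset.sum_add_distrib]
      exact Finset.sum_congr rfl fun r _ => by simp only [Pi.add_apply]; ring
    rw [hs]
    linear_combination (gram i p q l + gram i q p l) / 2
  have h6 : ∀ S : Fin 6, S = 0 ∨ S = 1 ∨ S = 2 ∨ S = 3 ∨ S = 4 ∨ S = 5 := by decide
  ext S S'
  rcases h6 S with rfl | rfl | rfl | rfl | rfl | rfl <;>
    rcases h6 S' with rfl | rfl | rfl | rfl | rfl | rfl <;>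
    · simp only [N6, M6, Matrix.of_apply, Matrix.cons_val, Matrix.one_apply]
      rw [gramHat, permanent_of_rows, permanent_of_rows]
      simp
      try norm_num

/-- **THE GENERIC CASE OF P1.**  With at most eleven squares and purity, three kernel combinations
`x_i = Σ ξ^i_{bk} n_{bk}` (`ξ^i` diagonal-plus-antisymmetric) whose functionals are independent —
witnessed by a `3 × 3` pairing certificate against tests `g` — together with three such combinations
`y_j = Σ η^j_{al} m_{al}` on the `μ`-side (tests `h`) are contradictory: `|ι| ≥ 6 + 3 + 3`. [folklore] -/
theorem false_of_allX_of_kernel_three_three (hι : Fintype.card ι ≤ 11)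
    (hJ : ∀ a b y₂ y₃ : Fin 4 → K,
      ∑ r, c r * (t r (a, b) (y₂, y₃)) ^ 2 = (Matrix.of ![a, b, y₂, y₃]).permanent)
    (hX : ∀ k : Fin 4, (∀ (a : Fin 4 → K) r, t r (a, 0) (Pi.single k 1, 0) = 0) ∧
        (∀ (b : Fin 4 → K) r, t r (0, b) (0, Pi.single k 1) = 0))
    (ξ η : Fin 3 → Fin 4 → Fin 4 → K) (hξ : ∀ i b k, b ≠ k → ξ i b k = -ξ i k b)
    (hη : ∀ j a l, a ≠ l → η j a l = -η j l a) (g h : Fin 3 → ι → K)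
    (hdetg : (Matrix.of fun i i' : Fin 3 => ∑ r, c r *
        (∑ b, ∑ k, ξ i b k * t r (0, Pi.single b 1) (Pi.single k 1, 0)) * g i' r).det ≠ 0)
    (hdeth : (Matrix.of fun j j' : Fin 3 => ∑ r, c r *
        (∑ a, ∑ l, η j a l * t r (Pi.single a 1, 0) (0, Pi.single l 1)) * h j' r).det ≠ 0) :
    False := by
  set n : Fin 4 → Fin 4 → ι → K := fun j k r => t r (0, Pi.single j 1) (Pi.single k 1, 0) with hn
  set m : Fin 4 → Fin 4 → ι → K := fun i l r => t r (Pi.single i 1, 0) (0, Pi.single l 1) with hm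
  set N6 : Fin 6 → ι → K :=
    ![n 0 1 + n 1 0, n 0 2 + n 2 0, n 0 3 + n 3 0, n 1 2 + n 2 1, n 1 3 + n 3 1, n 2 3 + n 3 2]
    with hN6
  set M6 : Fin 6 → ι → K := ![m 2 3, m 1 3, m 1 2, m 0 3, m 0 2, m 0 1] with hM6
  set x : Fin 3 → ι → K := fun i r => ∑ b, ∑ k, ξ i b k * n b k r with hx
  set y : Fin 3 → ι → K := fun j r => ∑ a, ∑ l, η j a l * m a l r with hy
  have hpair : (Matrix.of fun S S' : Fin 6 => ∑ r, c r * N6 S r * M6 S' r) = 1 :=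
    pairing_N6_M6 c t hJ hX
  -- the transposed design (swap the roles of `(a, y₃)` and `(b, y₂)`) is again pure
  let sw : ((Fin 4 → K) × (Fin 4 → K)) →ₗ[K] ((Fin 4 → K) × (Fin 4 → K)) :=
    { toFun := fun u => (u.2, u.1)
      map_add' := fun u v => rfl
      map_smul' := fun s u => rfl }
  let t' : ι → (((Fin 4 → K) × (Fin 4 → K)) →ₗ[K] ((Fin 4 → K) × (Fin 4 → K)) →ₗ[K] K) :=
    fun r => ((t r).comp sw).compl₂ sw
  have ht' : ∀ r (a b y₂ y₃ : Fin 4 → K), t' r (a, b) (y₂, y₃) = t r (b, a) (y₃, y₂) :=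
    fun r a b y₂ y₃ => rfl
  have hJ' : ∀ a b y₂ y₃ : Fin 4 → K,
      ∑ r, c r * (t' r (a, b) (y₂, y₃)) ^ 2 = (Matrix.of ![a, b, y₂, y₃]).permanent := by
    intro a b y₂ y₃
    simp_rw [ht']
    rw [hJ b a y₃ y₂, per_swap_row₀₁, per_swap_row₂₃]
  have hX' : ∀ k : Fin 4, (∀ (a : Fin 4 → K) r, t' r (a, 0) (Pi.single k 1, 0) = 0) ∧
      (∀ (b : Fin 4 → K) r, t' r (0, b) (0, Pi.single k 1) = 0) :=
    fun k => ⟨fun a r => by rw [ht']; exact (hX k).2 a r, fun b r => by rw [ht']; exact (hX k).1 b r⟩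
  -- orthogonality facts
  have hxm : ∀ i a l, ∑ r, c r * x i r * m a l r = 0 := fun i a l =>
    kernel_comb_orth_m c t hJ hX (ξ i) (hξ i) a l
  have hyn : ∀ j b k, ∑ r, c r * y j r * n b k r = 0 := by
    intro j b k
    have h := kernel_comb_orth_m c t' hJ' hX' (η j) (hη j) b k
    simpa [ht'] using h
  refine absurd (twelve_le_card_of_six_three_three c N6 M6 x g y h ?_ ?_ hdetg ?_ ?_ hdeth) (by omega)
  · rw [hpair]; simp
  · intro i T
    have h6 : T = 0 ∨ T = 1 ∨ T = 2 ∨ T = 3 ∨ T = 4 ∨ T = 5 := by revert T; decide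
    rcases h6 with rfl | rfl | rfl | rfl | rfl | rfl <;>
      · simp only [hM6, Matrix.cons_val]; exact hxm i _ _
  · intro j T
    have h6 : T = 0 ∨ T = 1 ∨ T = 2 ∨ T = 3 ∨ T = 4 ∨ T = 5 := by revert T; decide
    rcases h6 with rfl | rfl | rfl | rfl | rfl | rfl <;>
      · simp only [hN6, Matrix.cons_val, Pi.add_apply, mul_add, Finset.sum_add_distrib, hyn,
          add_zero]
  · intro j i
    calc ∑ r, c r * y j r * x i r = ∑ b, ∑ k, ξ i b k * ∑ r, c r * y j r * n b k r := by
          simp only [hx, Finset.mul_sum]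
          rw [Finset.sum_comm]
          refine Finset.sum_congr rfl fun b _ => ?_
          rw [Finset.sum_comm]
          exact Finset.sum_congr rfl fun k _ => Finset.sum_congr rfl fun r _ => by ring
      _ = 0 := Finset.sum_eq_zero fun b _ => Finset.sum_eq_zero fun k _ => by
          rw [hyn j b k, mul_zero]

/-- **THE CASE `A = 0` OF P1**: if the `ν`-Gram vanishes identically the six `N̂_S` are isotropic and
dual to the `m_{Sᶜ}`, hence `|ι| ≥ 12` — contradiction with `|ι| ≤ 11`. [folklore] -/
theorem false_of_allX_of_nGram_zero (hι : Fintype.card ι ≤ 11)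
    (hJ : ∀ a b y₂ y₃ : Fin 4 → K,
      ∑ r, c r * (t r (a, b) (y₂, y₃)) ^ 2 = (Matrix.of ![a, b, y₂, y₃]).permanent)
    (hX : ∀ k : Fin 4, (∀ (a : Fin 4 → K) r, t r (a, 0) (Pi.single k 1, 0) = 0) ∧
        (∀ (b : Fin 4 → K) r, t r (0, b) (0, Pi.single k 1) = 0))
    (h0 : ∀ b k b' k' : Fin 4, ∑ r, c r * t r (0, Pi.single b 1) (Pi.single k 1, 0) *
        t r (0, Pi.single b' 1) (Pi.single k' 1, 0) = 0) : False := by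
  set n : Fin 4 → Fin 4 → ι → K := fun j k r => t r (0, Pi.single j 1) (Pi.single k 1, 0) with hn
  set m : Fin 4 → Fin 4 → ι → K := fun i l r => t r (Pi.single i 1, 0) (0, Pi.single l 1) with hm
  set N6 : Fin 6 → ι → K :=
    ![n 0 1 + n 1 0, n 0 2 + n 2 0, n 0 3 + n 3 0, n 1 2 + n 2 1, n 1 3 + n 3 1, n 2 3 + n 3 2]
    with hN6
  set M6 : Fin 6 → ι → K := ![m 2 3, m 1 3, m 1 2, m 0 3, m 0 2, m 0 1] with hM6
  have hpair : (Matrix.of fun S S' : Fin 6 => ∑ r, c r * N6 S r * M6 S' r) = 1 :=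
    pairing_N6_M6 c t hJ hX
  have hnn : ∀ b k b' k', ∑ r, c r * n b k r * n b' k' r = 0 := fun b k b' k' => h0 b k b' k'
  have hiso : ∀ S S' : Fin 6, ∑ r, c r * N6 S r * N6 S' r = 0 := by
    intro S S'
    have h6 : ∀ T : Fin 6, T = 0 ∨ T = 1 ∨ T = 2 ∨ T = 3 ∨ T = 4 ∨ T = 5 := by decide
    rcases h6 S with rfl | rfl | rfl | rfl | rfl | rfl <;>
      rcases h6 S' with rfl | rfl | rfl | rfl | rfl | rfl <;>
      · simp only [hN6, Matrix.cons_val, Pi.add_apply, mul_add, add_mul, Finset.sum_add_distrib,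
          hnn, add_zero]
  refine absurd (twelve_le_card_of_isotropic_six c N6 M6 hiso ?_) (by omega)
  rw [hpair]; simp

end design

end Summit.ValiantsHypothesis.ValiantsHypothesis.Theorems.SymPencilPerFourInnerRankPureGramCount

end
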